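import Literature.Geometry.Lorentzian.KillingHorizonShadowAlong
import Literature.Geometry.Manifold.MaximalIntegralCurve
import Literature.Geometry.Lorentzian.StaticBlackHoleUniquenessProofs
import Literature.Geometry.Lorentzian.CausalityOpennessProofs

/-!
# Stub `stub_collarNullTangent` (P5) of crux `HawkingExtensionIsKerr`, line `SketchIdeator2`

Data: a FUTURE-PRESENTED stationary asymptotically flat black hole `𝓑` (every event lies in
`I⁺(M_ext)`, so that `⟨⟨M_ext⟩⟩ = I⁻(M_ext) =: P` and `𝓔⁺ = ∂P`), a Killing field `K` on an open
`U ⊇ 𝓔⁺`, timelike on `U ∩ ⟨⟨M_ext⟩⟩`, and a Killing field `K'` of `⟨⟨M_ext⟩⟩` with `K' = K` on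
`U' ∩ ⟨⟨M_ext⟩⟩` (`U' ⊇ 𝓔⁺` open) all of whose orbits in `⟨⟨M_ext⟩⟩` are whole lines staying in
`⟨⟨M_ext⟩⟩`.  Conclusion: at every `p ∈ 𝓔⁺`, `K` is null and some integral curve of `K` through
`p` on a short open interval stays in `𝓔⁺`.

Proof.  (0) Globalise `K` near `p` by a smooth bump function supported in `W = U ∩ U'`
(`SmoothBumpFunction`, `ContMDiffOn.smul_section_of_tsupport`) and take the `C^∞` local flow
`Φ` of the globalised field about `p` (`Literature.Geometry.Manifold.exists_localFlow`), shrunk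
so that `Φ x t` stays in the open set `W₁ ⊆ W` where the bump is `1` (continuity of the flow);
there the flow lines are integral curves of `K`.  (1) KEY LEMMA
(`stub_collarNullTangent_mem_of_isMIntegralCurveOn`): an integral curve of `K` inside `W₁` on an
open interval which meets `⟨⟨M_ext⟩⟩` at one time lies in `⟨⟨M_ext⟩⟩` at all times — it coincides
with the (re-based) complete `K'`-line through the meeting point, by local uniqueness of integral
curves and a clopen argument.  Hence (CLAIM A) the flow line `γ = Φ p` through `p ∈ 𝓔⁺`
(`𝓔⁺ ∩ ⟨⟨M_ext⟩⟩ = ∅`) never meets `⟨⟨M_ext⟩⟩ = P`, and (CLAIM B) `γ t ∈ closure P`: otherwise,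
by continuity of `x ↦ Φ x t` at `p ∈ closure ⟨⟨M_ext⟩⟩`, some d.o.c. point `x` near `p` would
have `Φ x t ∉ closure P`, against the key lemma.  So `γ t ∈ closure P ∖ P = ∂P = 𝓔⁺`
(tangency).  (2) NULLITY: `g(K, K)(p) ≤ 0` by continuity (`< 0` on `U ∩ ⟨⟨M_ext⟩⟩ ∋` points
arbitrarily close to `p`).  If `g(K, K)(p) < 0`, `K p` is future- or past-directed timelike, and
by continuity (openness of the timecone bundle) a short piece `γ|[-s, s]` is a timelike curve
through `p`, future-directed for `τ` or for `τ.reverse`; accordingly `γ (-s)` or `γ s` lies in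
`I⁻(p) ⊆ I⁻(M_ext) = P` (`p ∈ closure P`, `I⁺(y)` open, transitivity of `≪`), i.e. in
`⟨⟨M_ext⟩⟩`, contradicting CLAIM A.
-/

noncomputable section

set_option linter.dupNamespace false

namespace Summit.FinalStateConjecture.FinalStateConjecture.Theorems.HawkingExtensionIsKerr.SketchIdeator2

open Set Function Filter Bundle Literature.Geometry.Lorentzian
open scoped Manifold ContDiff Topology

section FlowInvariance

variable {E : Type*} [NormedAddCommGroup E] [NormedSpace ℝ E] {H : Type*} [TopologicalSpace H]
  {I : ModelWithCorners ℝ E H} {M : Type*} [TopologicalSpace M] [ChartedSpace H M]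
  [IsManifold I 1 M] [T2Space M] [BoundarylessManifold I M]

/-- **A region swept by complete `K'`-lines is invariant under the integral curves of any `C¹`
field `K` extending `K'`.**  Let `K` be `C¹` at the points of an open set `O`, `K' = K` on
`O ∩ D`, and suppose every point of `D` lies on a whole-line integral curve of `K'` staying in
`D`.  Then an integral curve `c ⊆ O` of `K` on an open interval `J` which is in `D` at one time
`t₀ ∈ J` is in `D` at every time of `J`: the `K'`-line `δ` through `c t₀`, re-based at `t₀`, is an
integral curve of `K` near every time at which it agrees with `c` (there it lies in the open set
`O`, and in `D`), so by local uniqueness of integral curves (Mathlib's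
`isMIntegralCurveAt_eventuallyEq_of_contMDiffAt_boundaryless`) the set of times of local agreement
is open; the set of times of disagreement is open too (Hausdorff), and `J` is connected, so
`c = δ ∈ D` on `J`.  Lee 2012, Thm. 9.12 (a) (uniqueness of integral curves; clopen argument).
[folklore] -/
private theorem stub_collarNullTangent_mem_of_isMIntegralCurveOn
    {K K' : Π x : M, TangentSpace I x} {O D : Set M} (hO : IsOpen O)
    (hK : ∀ x ∈ O, ContMDiffAt I I.tangent 1 (fun y ↦ (⟨y, K y⟩ : TangentBundle I M)) x)
    (hK'K : ∀ x ∈ O ∩ D, K' x = K x)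
    (hD : ∀ x ∈ D, ∃ δ : ℝ → M, IsMIntegralCurve δ K' ∧ δ 0 = x ∧ ∀ t, δ t ∈ D)
    {c : ℝ → M} {J : Set ℝ} (hJ : IsOpen J) (hJc : J.OrdConnected) (hc : IsMIntegralCurveOn c K J)
    (hcO : ∀ s ∈ J, c s ∈ O) {t₀ : ℝ} (ht₀ : t₀ ∈ J) (hct₀ : c t₀ ∈ D) {t : ℝ} (ht : t ∈ J) :
    c t ∈ D := by
  obtain ⟨δ, hδ, hδ0, hδD⟩ := hD _ hct₀
  have hδ' : IsMIntegralCurve (δ ∘ (· - t₀)) K' := isMIntegralCurve_comp_sub.2 hδ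
  have hδc : Continuous (δ ∘ (· - t₀)) := hδ'.continuous
  -- the (open) set of times of local agreement of `c` with the re-based line
  set u : Set ℝ := {s | ∀ᶠ r in 𝓝 s, c r = (δ ∘ (· - t₀)) r}
  have hJu : ∀ s ∈ J, c s = (δ ∘ (· - t₀)) s → s ∈ u := fun s hs h ↦ by
    have hOs : ∀ᶠ r in 𝓝 s, (δ ∘ (· - t₀)) r ∈ O :=
      hδc.continuousAt.preimage_mem_nhds (hO.mem_nhds (h ▸ hcO s hs))
    have hδK : IsMIntegralCurveAt (δ ∘ (· - t₀)) K s := hOs.mono fun r hr ↦ by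
      have hd := hδ' r
      rwa [hK'K _ ⟨hr, hδD _⟩] at hd
    exact isMIntegralCurveAt_eventuallyEq_of_contMDiffAt_boundaryless (hK _ (hcO s hs))
      (hc.isMIntegralCurveAt (hJ.mem_nhds hs)) hδK h
  -- it is all of `J` (the times of disagreement form an open set, `J` is connected)
  have hsub : J ⊆ u := by
    refine hJc.isPreconnected.subset_left_of_subset_union isOpen_setOf_eventually_nhds
      ((hc.continuousOn.prodMk hδc.continuousOn).isOpen_inter_preimage hJ
        isClosed_diagonal.isOpen_compl) ?_ ?_ ⟨t₀, ht₀, hJu t₀ ht₀ (by simp [hδ0])⟩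
    · exact Set.disjoint_left.2 fun s hsu hsv ↦ absurd (Eventually.self_of_nhds hsu) hsv.2
    · intro s hs
      by_cases h : c s = (δ ∘ (· - t₀)) s
      · exact Or.inl (hJu s hs h)
      · exact Or.inr ⟨hs, h⟩
  have hmem : ∀ᶠ r in 𝓝 t, c r = (δ ∘ (· - t₀)) r := hsub ht
  rw [hmem.self_of_nhds]
  exact hδD _

end FlowInvariance

/-- **Stub P5 (worker): the collar field is null on `𝓔⁺` and tangent to it.**  For a
future-presented `𝓑` (`⟨⟨M_ext⟩⟩ = I⁻(M_ext) = P`, `𝓔⁺ = ∂P`), a Killing field `K` on an open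
`U ⊇ 𝓔⁺`, timelike on `U ∩ ⟨⟨M_ext⟩⟩`, equal on `U' ∩ ⟨⟨M_ext⟩⟩` to a Killing field `K'` of
`⟨⟨M_ext⟩⟩` with complete orbits inside `⟨⟨M_ext⟩⟩`: at each `p ∈ 𝓔⁺`, `g(K, K)(p) = 0` and an
integral curve of `K` through `p` stays in `𝓔⁺` for short times.  The local flow of (a
globalisation of) `K` near `p` preserves `⟨⟨M_ext⟩⟩` (key lemma: flow lines through d.o.c. points
are the complete `K'`-lines), hence, by continuity, `closure ⟨⟨M_ext⟩⟩`, and the line through `p`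
misses `⟨⟨M_ext⟩⟩` — so it runs in `∂P = 𝓔⁺`; were `K p` timelike, a short timelike piece of
that line would put one of its points in `I⁻(p) ⊆ I⁻(M_ext) = ⟨⟨M_ext⟩⟩`. -/
theorem stub_collarNullTangent :
    ∀ (𝓑 : StationaryAFBlackHole.{0}) [𝓑.metric.HasLeviCivita],
      (∀ p : 𝓑.carrier, p ∈ 𝓑.metric.chronologicalFuture 𝓑.timeOrientation 𝓑.Mext) →
      ∀ (U U' : Set 𝓑.carrier) (K K' : Π x : 𝓑.carrier, TangentSpace (𝓡 4) x),
        IsOpen U → 𝓑.horizon ⊆ U → 𝓑.metric.toPseudoRiemannianMetric.IsKillingFieldOn K U →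
        (∀ x ∈ U ∩ 𝓑.doc, 𝓑.metric.val x (K x) (K x) < 0) →
        IsOpen U' → 𝓑.horizon ⊆ U' → (∀ x ∈ U' ∩ 𝓑.doc, K' x = K x) →
        𝓑.metric.toPseudoRiemannianMetric.IsKillingFieldOn K' 𝓑.doc →
        (∀ x ∈ 𝓑.doc, ∃ δ : ℝ → 𝓑.carrier, IsMIntegralCurve δ K' ∧ δ 0 = x ∧ ∀ t, δ t ∈ 𝓑.doc) →
        ∀ p ∈ 𝓑.horizon, 𝓑.metric.val p (K p) (K p) = 0 ∧
          ∃ ε > (0 : ℝ), ∃ γ : ℝ → 𝓑.carrier, γ 0 = p ∧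
            IsMIntegralCurveOn γ K (Set.Ioo (-ε) ε) ∧ ∀ t ∈ Set.Ioo (-ε) ε, γ t ∈ 𝓑.horizon := by
  intro 𝓑 _ hfut U U' K K' hU hHU hKon hKtl hU' hHU' hK'K _ hK'comp p hp
  -- openness of `I^±`, and the future-presented picture: `doc = P := I⁻(M_ext)`, `𝓔⁺ = ∂P`
  have hF : 𝓑.metric.isOpen_chronologicalFuture 𝓑.timeOrientation :=
    LorentzianMetric.isOpen_chronologicalFuture_holds_of_boundaryless
  have hP : 𝓑.metric.isOpen_chronologicalPast 𝓑.timeOrientation :=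
    LorentzianMetric.isOpen_chronologicalPast_holds_of_boundaryless
  set τ := 𝓑.timeOrientation
  set P : Set 𝓑.carrier := 𝓑.metric.chronologicalPast τ 𝓑.Mext
  have hdocP : ∀ {x}, x ∈ P → x ∈ 𝓑.doc := fun hx ↦ ⟨hfut _, hx⟩
  have hhor : ∀ x, x ∈ closure P → x ∉ 𝓑.doc → x ∈ 𝓑.horizon := fun x hcl hnd ↦
    ⟨⟨hcl, fun hi ↦ hnd (hdocP (interior_subset hi))⟩, hfut x⟩
  have hpdoc : p ∉ 𝓑.doc := Set.disjoint_left.1 (𝓑.disjoint_horizon_doc hP) hp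
  have hpcl : p ∈ closure 𝓑.doc := 𝓑.horizon_subset_closure_doc hF hP hp
  -- (0) globalise `K` near `p` (bump function supported in `U ∩ U'`) and take the local flow
  obtain ⟨f, -, hfW⟩ := (SmoothBumpFunction.nhds_basis_tsupport (I := 𝓡 4) p).mem_iff.1
    ((hU.inter hU').mem_nhds ⟨hHU hp, hHU' hp⟩)
  have hLs : ContMDiff (𝓡 4) (𝓡 4).tangent ∞ fun x ↦
      (TotalSpace.mk' E4 x (((f : 𝓑.carrier → ℝ) • K) x) : TangentBundle (𝓡 4) 𝓑.carrier) :=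
    ContMDiffOn.smul_section_of_tsupport f.contMDiff.contMDiffOn (hU.inter hU') hfW
      (hKon.contMDiffOn.mono inter_subset_left)
  obtain ⟨N, hNo, hpN, ε₀, hε₀, Φ, hΦ0, hΦL, hΦs⟩ :=
    Literature.Geometry.Manifold.exists_localFlow (n := (⊤ : ℕ∞)) hLs le_top
      (BoundarylessManifold.isInteriorPoint (x := p))
  -- the open set `W₁ ∋ p` where the bump is `1` (there the globalised field is `K`)
  set W₁ : Set 𝓑.carrier := interior {x | f x = 1}
  have hW₁o : IsOpen W₁ := isOpen_interior
  have hpW₁ : p ∈ W₁ := mem_interior_iff_mem_nhds.2 f.eventuallyEq_one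
  have hf1 : ∀ x ∈ W₁, f x = 1 := fun x hx ↦
    show x ∈ {y | f y = 1} from interior_subset hx
  have hW₁W : W₁ ⊆ U ∩ U' := fun x hx ↦ hfW (subset_tsupport _ (Function.mem_support.2
    (by rw [hf1 x hx]; exact one_ne_zero)))
  have hLK : ∀ x ∈ W₁, ((f : 𝓑.carrier → ℝ) • K) x = K x := fun x hx ↦ by
    rw [Pi.smul_apply', hf1 x hx, one_smul]
  -- shrink the flow domain so that the flow stays in `W₁`
  have hcont : ContinuousOn (fun q : 𝓑.carrier × ℝ ↦ Φ q.1 q.2) (N ×ˢ Ioo (-ε₀) ε₀) :=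
    hΦs.continuousOn
  obtain ⟨N₂, V, hN₂o, hVo, hpN₂, h0V, hNV⟩ := isOpen_prod_iff.1
    (hcont.isOpen_inter_preimage (hNo.prod isOpen_Ioo) hW₁o) p 0
    ⟨⟨hpN, neg_lt_zero.2 hε₀, hε₀⟩, show Φ p 0 ∈ W₁ by rw [hΦ0 p hpN]; exact hpW₁⟩
  obtain ⟨ε, hε, hεV⟩ : ∃ ε > (0 : ℝ), Ioo (-ε) ε ⊆ V := by
    obtain ⟨ε, hε, h⟩ := Metric.isOpen_iff.1 hVo 0 h0V
    exact ⟨ε, hε, by rwa [Real.ball_eq_Ioo, zero_sub, zero_add] at h⟩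
  have h0 : (0 : ℝ) ∈ Ioo (-ε) ε := ⟨neg_lt_zero.2 hε, hε⟩
  have hflow : ∀ x ∈ N₂, x ∈ N ∧ ∀ t ∈ Ioo (-ε) ε, t ∈ Ioo (-ε₀) ε₀ ∧ Φ x t ∈ W₁ := fun x hx ↦
    ⟨(hNV (mk_mem_prod hx (hεV h0))).1.1,
      fun t ht ↦ ⟨(hNV (mk_mem_prod hx (hεV ht))).1.2, (hNV (mk_mem_prod hx (hεV ht))).2⟩⟩
  have hint : ∀ x ∈ N₂, IsMIntegralCurveOn (Φ x) K (Ioo (-ε) ε) := fun x hx t ht ↦ by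
    have h := (hΦL x (hflow x hx).1).mono (fun s hs ↦ ((hflow x hx).2 s hs).1) t ht
    rwa [hLK _ ((hflow x hx).2 t ht).2] at h
  -- (1) the key lemma along the flow: flow lines meeting the d.o.c. stay in it
  have hKW₁ : ∀ x ∈ W₁, ContMDiffAt (𝓡 4) (𝓡 4).tangent 1
      (fun y ↦ (TotalSpace.mk' E4 y (K y) : TangentBundle (𝓡 4) 𝓑.carrier)) x := fun x hx ↦
    (hKon.contMDiffAt hU (hW₁W hx).1).of_le (by exact_mod_cast le_top)
  have hK'W₁ : ∀ x ∈ W₁ ∩ 𝓑.doc, K' x = K x := fun x hx ↦ hK'K x ⟨(hW₁W hx.1).2, hx.2⟩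
  have hstay : ∀ x ∈ N₂, ∀ t₀ ∈ Ioo (-ε) ε, Φ x t₀ ∈ 𝓑.doc → ∀ t ∈ Ioo (-ε) ε, Φ x t ∈ 𝓑.doc :=
    fun x hx t₀ ht₀ h t ht ↦ stub_collarNullTangent_mem_of_isMIntegralCurveOn hW₁o hKW₁ hK'W₁
      hK'comp isOpen_Ioo ordConnected_Ioo (hint x hx) (fun s hs ↦ ((hflow x hx).2 s hs).2) ht₀ h ht
  -- the flow line through `p`
  have hγ0 : Φ p 0 = p := hΦ0 p (hflow p hpN₂).1
  have hγint : IsMIntegralCurveOn (Φ p) K (Ioo (-ε) ε) := hint p hpN₂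
  -- CLAIM A: it never meets the d.o.c.
  have hγdoc : ∀ t ∈ Ioo (-ε) ε, Φ p t ∉ 𝓑.doc := fun t ht h ↦
    hpdoc (hγ0 ▸ hstay p hpN₂ t ht h 0 h0)
  -- CLAIM B and tangency: it stays in `closure P ∖ P = 𝓔⁺`
  have htan : ∀ t ∈ Ioo (-ε) ε, Φ p t ∈ 𝓑.horizon := by
    intro t ht
    have hcl : Φ p t ∈ closure P := by
      by_contra hB
      have hct : ContinuousAt (fun x ↦ Φ x t) p :=
        (hcont.comp (continuous_id.prodMk continuous_const).continuousOn
          fun x hx ↦ ⟨hx, ((hflow p hpN₂).2 t ht).1⟩).continuousAt (hNo.mem_nhds hpN)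
      obtain ⟨x, ⟨hxB, hxN₂⟩, hxdoc⟩ := mem_closure_iff_nhds.1 hpcl _
        (inter_mem (hct.preimage_mem_nhds (isClosed_closure.isOpen_compl.mem_nhds hB))
          (hN₂o.mem_nhds hpN₂))
      exact hxB (subset_closure
        (hstay x hxN₂ 0 h0 (by rw [hΦ0 x (hflow x hxN₂).1]; exact hxdoc) t ht).2)
    exact hhor _ hcl (hγdoc t ht)
  -- (2) nullity at `p`: `g(K, K)(p) ≤ 0` by continuity ...
  have hKc : ContinuousAt
      (fun x ↦ (TotalSpace.mk' E4 x (K x) : TangentBundle (𝓡 4) 𝓑.carrier)) p :=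
    (hKon.contMDiffAt hU (hHU hp)).continuousAt
  have hle : 𝓑.metric.val p (K p) (K p) ≤ 0 := by
    have hc : ContinuousAt (fun x ↦ 𝓑.metric.val x (K x) (K x)) p :=
      (LorentzianMetric.continuous_val_snd_snd 𝓑.metric τ).1.continuousAt.comp hKc
    have h1 := hc.continuousWithinAt.mem_closure_image (hU.inter_closure ⟨hHU hp, hpcl⟩)
    have h2 : (fun x ↦ 𝓑.metric.val x (K x) (K x)) '' (U ∩ 𝓑.doc) ⊆ Iio 0 := by
      rintro _ ⟨x, hx, rfl⟩
      exact hKtl x hx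
    have h3 := closure_mono h2 h1
    rwa [closure_Iio] at h3
  -- ... `I⁻(p) ⊆ I⁻(M_ext) = P` since `p ∈ closure P` ...
  have hIp : 𝓑.metric.chronologicalPast τ {p} ⊆ P := fun y hy ↦ by
    have hyp := LorentzianMetric.mem_chronologicalFuture_of_mem_chronologicalPast hy
    obtain ⟨p', hp'y, hp'P⟩ := mem_closure_iff_nhds.1 (frontier_subset_closure hp.1) _
      ((LorentzianMetric.isOpen_chronologicalFuture_of_boundaryless _ _ _).mem_nhds hyp)
    exact LorentzianMetric.mem_chronologicalFuture_trans (τ := τ.reverse) hp'P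
      (LorentzianMetric.mem_chronologicalPast_of_mem_chronologicalFuture hp'y)
  -- ... and a timelike `K p` would put a point of the flow line through `p` in `I⁻(p)`
  have hnull : 𝓑.metric.val p (K p) (K p) = 0 := by
    refine le_antisymm hle (not_lt.1 fun hlt ↦ ?_)
    have hγc : ContinuousAt (fun t ↦
        (TotalSpace.mk' E4 (Φ p t) (K (Φ p t)) : TangentBundle (𝓡 4) 𝓑.carrier)) 0 :=
      hKc.comp_of_eq (hγint.continuousOn.continuousAt (Ioo_mem_nhds h0.1 h0.2)) hγ0
    -- a short piece of the flow line through `p` is a timelike curve (for `τ'` = `τ` or `-τ`)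
    have hseg : ∀ τ' : TimeOrientation 𝓑.metric, τ'.IsFutureDirected (K p) →
        ∃ s > (0 : ℝ), Icc (-s) s ⊆ Ioo (-ε) ε ∧
          𝓑.metric.IsFutureTimelikeCurveOn τ' (Φ p) (Icc (-s) s) := by
      intro τ' hfd
      have hp0 : (TotalSpace.mk' E4 (Φ p 0) (K (Φ p 0)) : TangentBundle (𝓡 4) 𝓑.carrier) ∈
          LorentzianMetric.futureTimecone 𝓑.metric τ' := by
        rw [hγ0]
        exact LorentzianMetric.mem_futureTimecone_iff.2 ⟨hlt, hfd⟩
      have hev : ∀ᶠ t in 𝓝 (0 : ℝ), (TotalSpace.mk' E4 (Φ p t) (K (Φ p t)) :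
          TangentBundle (𝓡 4) 𝓑.carrier) ∈ LorentzianMetric.futureTimecone 𝓑.metric τ' ∧
            t ∈ Ioo (-ε) ε :=
        (hγc.eventually_mem ((LorentzianMetric.isOpen_futureTimecone _ τ').mem_nhds hp0)).and
          (eventually_mem_set.2 (Ioo_mem_nhds h0.1 h0.2))
      obtain ⟨s, hs, hball⟩ := (nhds_basis_Icc_pos (0 : ℝ)).eventually_iff.1 hev
      simp only [zero_sub, zero_add] at hball
      refine ⟨s, hs, fun t ht ↦ (hball ht).2, fun t ht ↦ ?_⟩
      obtain ⟨hcone, htI⟩ := hball ht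
      have hd := hγint.hasMFDerivAt_of_isOpen isOpen_Ioo htI
      have hvel : velocity (𝓡 4) (Φ p) t = K (Φ p t) := by
        rw [velocity, hd.mfderiv]
        exact one_smul ℝ _
      rw [hvel]
      exact ⟨hd.mdifferentiableAt, LorentzianMetric.mem_futureTimecone_iff.1 hcone⟩
    obtain ⟨t, ht, htp⟩ : ∃ t ∈ Ioo (-ε) ε, Φ p t ∈ 𝓑.metric.chronologicalPast τ {p} := by
      rcases τ.isFutureDirected_or_isPastDirected_of_isCausal
        (show 𝓑.metric.IsTimelike (K p) from hlt).isCausal with hf | hpa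
      · obtain ⟨s, hs, hsI, hcu⟩ := hseg τ hf
        exact ⟨-s, hsI ⟨le_rfl, by linarith⟩,
          LorentzianMetric.mem_chronologicalPast_of_mem_chronologicalFuture
            ⟨Φ p (-s), rfl, Φ p, -s, 0, by linarith, hcu.mono (Icc_subset_Icc le_rfl hs.le),
              rfl, hγ0⟩⟩
      · obtain ⟨s, hs, hsI, hcu⟩ := hseg τ.reverse ((τ.isFutureDirected_reverse_iff _).2 hpa)
        exact ⟨s, hsI ⟨by linarith, le_rfl⟩, p, rfl, Φ p, 0, s, hs,
          hcu.mono (Icc_subset_Icc (by linarith) le_rfl), hγ0, rfl⟩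
    exact hγdoc t ht (hdocP (hIp htp))
  exact ⟨hnull, ε, hε, Φ p, hγ0, hγint, htan⟩

end Summit.FinalStateConjecture.FinalStateConjecture.Theorems.HawkingExtensionIsKerr.SketchIdeator2

end
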